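import Literature.Computability.Complexity.MurrayWilliams2018Headline
import Literature.Computability.Complexity.Williams2014Fact31Proofs
import Literature.Computability.Complexity.Williams2014Proofs
import HarnessLib

/-!
# Murray–Williams' headline `NQP ⊄ ACC⁰`: the two remaining leaves

Serves the named fact
`Literature.Computability.Complexity.MurrayWilliams2018_NQP_not_subset_ACC0 : ¬ (NQP ⊆ ACC0)`
(`CircuitLowerBounds.lean`; C. D. Murray, R. R. Williams, *Circuit lower bounds for
nondeterministic quasi-polytime: an easy witness lemma for NP and NQP*, STOC 2018, §1.1 and
Thm. 1.3). `MurrayWilliams2018Headline.lean` proves the headline from four hypotheses: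
the Easy Witness Lemma 4.1 in almost-everywhere form (`MurrayWilliams2018_lemma_4_1_ae`, named
fact), Williams' efficient succinct Cook–Levin reduction (`Williams2014_fact_3_1`, named fact),
Williams' machine `B` run with subexponential succinct witnesses (`hB`, inline hypothesis) and
Williams' `ACC`-SAT algorithm (`Williams2014_thm_4_1`, named fact). Two of the four are meanwhile
THEOREMS of the tree: `Williams2014_fact_3_1_holds` (`Williams2014Fact31Proofs.lean`, the
clause-generator machine over the skeleton tableau) and `Williams2014_thm_4_1_holds`
(`Williams2014Proofs.lean`, the Beigel–Tarui conversion Lemma 4.1 with Yates' evaluation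
Lemma 4.2). This file records the composition, so that the trust base of the headline is read off
ONE theorem:

* **`MurrayWilliams2018_NQP_not_subset_ACC0_of_lemma_4_1_ae_of_machineB'`** — the headline
  `¬ (NQP ⊆ ACC0)` from `MurrayWilliams2018_lemma_4_1_ae` and the machine `B` at subexponential
  witness size only.

Hence, as of this file, `MurrayWilliams2018_NQP_not_subset_ACC0` rests on exactly one unproved
named fact of the literature — Murray–Williams' Easy Witness Lemma for low nondeterministic time,
Lemma 4.1 (`MurrayWilliams2018_lemma_4_1_ae`; its printed proof: Thm. 3.1, Umans' generator
Thm. 2.1, Santhanam's complete language Thm. 2.2, the diagonal language Thm. 2.3) — and on one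
machine construction of Williams (J. ACM 2014, proof of Thm. 3.2, pp. 12–13: the machine `B`,
here with the guessed witness circuit of size `a · 2^{⌊n^{1/q}⌋} + a` and the SAT call made to
the `2^{w - ⌊w^{1/r}⌋}`-time algorithm of Thm. 5.1 / Thm. 4.1; hypothesis `hB`, verbatim from
`MurrayWilliams2018Headline.lean`).

Kept in a separate leaf module for the reason given in `Williams2014Fact31Proofs.lean`: the
import closures of the two discharges (`SkeletonMachine`, the `Williams2014Conv*` series) are
large and disjoint from that of `MurrayWilliams2018Headline.lean`.

Theorems only; no definition and no named fact is introduced.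

## References

* C. D. Murray, R. R. Williams, *Circuit lower bounds for nondeterministic quasi-polytime: an easy
  witness lemma for NP and NQP*, STOC 2018, 890–901, §1.1, Thm. 1.3, Lemma 4.1, Thm. 5.1
  [MurrayWilliams2018].
* R. Williams, *Nonuniform ACC circuit lower bounds*, J. ACM 61 (2014) 2:1–2:32, Fact 3.1,
  proof of Thm. 3.2 (machine `B`), Thm. 4.1 [Williams2014].
-/

namespace Literature.Computability.Complexity

open Filter

/-- **The headline over its two remaining leaves**: Murray–Williams' Easy Witness Lemma 4.1
(a.e. form, named fact `MurrayWilliams2018_lemma_4_1_ae`) and Williams' machine `B` at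
subexponential witness size (hypothesis `hB`, verbatim that of
`MurrayWilliams2018_NQP_not_subset_ACC0_of_lemma_4_1_ae_of_machineB`) imply `¬ (NQP ⊆ ACC0)`;
Williams' Fact 3.1 and Theorem 4.1 are supplied by their discharges
`Williams2014_fact_3_1_holds` and `Williams2014_thm_4_1_holds`.
[cite: MurrayWilliams2018, §1.1 and Thm. 1.3] -/
theorem MurrayWilliams2018_NQP_not_subset_ACC0_of_lemma_4_1_ae_of_machineB'
    (h41 : MurrayWilliams2018_lemma_4_1_ae)
    (hB : ∀ (c : ℕ) (L : Language Bool) (cl : List Bool → ℕ → Clause ℕ) (m dG eG dW : ℕ),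
      IsSuccinctReduction c L cl → 2 ≤ m →
      NGenerates williamsBound (GoodClauseCircuits c cl m dG eG) →
      (∀ d' : ℕ, ∃ r : ℕ, 2 ≤ r ∧ AccSatSubexp d' m r) →
      ∃ q : ℕ, 1 ≤ q ∧
        ((∃ a : ℕ, ∀ x ∈ L, ∃ (k : ℕ) (W : Circuit (Fin k)), k ≤ succinctWidth c x.length ∧
            W.IsOver (accBasis m) ∧ W.acDepth ≤ dW ∧
            W.size ≤ a * 2 ^ Nat.nthRoot q x.length + a ∧
            (succinctCNF c cl x).eval W.assignment = true) →
          L ∈ NTIME williamsBound)) :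
    MurrayWilliams2018_NQP_not_subset_ACC0 :=
  MurrayWilliams2018_NQP_not_subset_ACC0_of_lemma_4_1_ae_of_machineB h41
    Williams2014_fact_3_1_holds hB Williams2014_thm_4_1_holds

end Literature.Computability.Complexity
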